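import Literature.Geometry.Manifold.ChartConePrism
import Literature.Geometry.Manifold.SmoothSingularCochains
import HarnessLib

/-!
# Smooth versus all singular cochains on a chart-convex set

Sixth brick of the integration proof of **de Rham's theorem**: the base case of Bredon's
bootstrap for the comparison "smooth singular cochains ← all singular cochains"
(Bredon, *Topology and Geometry* (1993), Lemma V.9.2 and Thm. V.9.5; Lee (2013), Thm. 18.7,
Step 1): on a chart-convex open set `U = chartSet I p C` (`C` open convex in the target of the
chart at `p`), restriction of cochains to smooth chains

`toSmooth U : Hom(C(U), N) ⟶ Hom(Δ^{sm}(U), N)`   (`…Manifold.smoothSubsetCochains.toSmooth`)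

induces isomorphisms on cohomology in every degree (`isIso_homologyMap_toSmooth_chartSet`).

Proof: the prism simplices of the chart contraction (`…Manifold.ChartConePrism`) of a *smooth*
simplex are smooth (`IsSmooth.prismSimplex`: the contraction is a `C^∞` expression in the chart),
so the prism operator preserves the smooth chains in `U`; by `isZero_homology_dualObj_succ` both
`H^{q+1}(Hom(C(U), N))` and `H^{q+1}(Hom(Δ^{sm}(U), N))` vanish, and in degree `0` both are the
cochains constant on points, identified by `toSmooth` (every `0`-simplex is smooth).

## References

* G. E. Bredon, *Topology and Geometry*, GTM 139 (1993), Lemma V.9.2, Thm. V.9.5.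
* J. M. Lee, *Introduction to Smooth Manifolds*, 2nd ed. (2013), Thm. 18.7.
-/

noncomputable section

-- see "Implementation notes" in `…SingularHomology.SingularChainsConcrete`
set_option backward.isDefEq.respectTransparency false

open scoped Manifold ContDiff Topology
open CategoryTheory Limits Set Literature.AlgebraicTopology.SingularHomology Literature.Geometry.Kaehler

universe u v

namespace Literature.Geometry.Manifold

variable {E : Type u} [NormedAddCommGroup E] [NormedSpace ℝ E]
  {H : Type*} [TopologicalSpace H] {I : ModelWithCorners ℝ E H}
  {M : Type u} [TopologicalSpace M] [ChartedSpace H M]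
  {p : M} {C : Set E} {c : E} {n k : ℕ}

/-! ### Prism simplices of smooth simplices are smooth -/

section Smooth

variable [IsManifold I ∞ M]

/-- The linear "base" map `ℝᵏ⁺¹ → ℝⁿ⁺¹` of a prism vertex map: `x ↦ ∑ⱼ xⱼ e_{(θ j).1}`. [folklore] -/
def prismBaseLin (θ : Fin (k + 1) → Fin (n + 1) × Fin 2) (x : Fin (k + 1) → ℝ) : Fin (n + 1) → ℝ :=
  ∑ j, x j • (Pi.single (θ j).1 (1 : ℝ) : Fin (n + 1) → ℝ)

/-- The linear "height" map `ℝᵏ⁺¹ → ℝ` of a prism vertex map: `x ↦ ∑ⱼ xⱼ ε_{θ j}`. [folklore] -/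
def prismHeightLin (θ : Fin (k + 1) → Fin (n + 1) × Fin 2) (x : Fin (k + 1) → ℝ) : ℝ :=
  ∑ j, x j * (((θ j).2 : Fin 2) : ℕ)

/-- The base map is smooth (linear). [folklore] -/
theorem contDiff_prismBaseLin (θ : Fin (k + 1) → Fin (n + 1) × Fin 2) : ContDiff ℝ ∞ (prismBaseLin θ) := by
  unfold prismBaseLin
  exact ContDiff.sum fun j _ ↦ (contDiff_apply ℝ ℝ j).smul contDiff_const

/-- The height map is smooth (linear). [folklore] -/
theorem contDiff_prismHeightLin (θ : Fin (k + 1) → Fin (n + 1) × Fin 2) :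
    ContDiff ℝ ∞ (prismHeightLin θ) := by
  unfold prismHeightLin
  exact ContDiff.sum fun j _ ↦ (contDiff_apply ℝ ℝ j).mul contDiff_const

/-- On the simplex, the base map is the base of `…Manifold.prismBase`. [folklore] -/
theorem prismBaseLin_eq_coe (θ : Fin (k + 1) → Fin (n + 1) × Fin 2) (t : StdSimplex k) :
    prismBaseLin θ t = (prismBase θ t).1 := by
  rw [prismBase, StdSimplex.stdSimplex_map_eq_affComb]
  rfl

/-- On the simplex, the height map is `…Manifold.prismHeight`. [folklore] -/
theorem prismHeightLin_eq (θ : Fin (k + 1) → Fin (n + 1) × Fin 2) (t : StdSimplex k) :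
    prismHeightLin θ t = prismHeight θ t :=
  rfl

/-- The base map sends `Δᵏ` into `Δⁿ`. [folklore] -/
theorem prismBaseLin_mem (θ : Fin (k + 1) → Fin (n + 1) × Fin 2) {x : Fin (k + 1) → ℝ}
    (hx : x ∈ stdSimplex ℝ (Fin (k + 1))) : prismBaseLin θ x ∈ stdSimplex ℝ (Fin (n + 1)) := by
  rw [show x = ((⟨x, hx⟩ : StdSimplex k) : Fin (k + 1) → ℝ) from rfl, prismBaseLin_eq_coe]
  exact (prismBase θ ⟨x, hx⟩).2

/-- The chart expression of a prism simplex: `x ↦ e⁻¹((1 - h x) e(σ~(a x)) + (h x) c)`. [folklore] -/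
def prismChartFun (I : ModelWithCorners ℝ E H) (p : M) (c : E) (σ : SingularSimplex M n)
    (θ : Fin (k + 1) → Fin (n + 1) × Fin 2) (x : Fin (k + 1) → ℝ) : M :=
  (extChartAt I p).symm
    ((1 - prismHeightLin θ x) • extChartAt I p (σ.bext (prismBaseLin θ x)) + prismHeightLin θ x • c)

omit [IsManifold I ∞ M] in
/-- On the simplex, the barycentric extension of a prism simplex is its chart expression. [folklore] -/
theorem bext_prismSimplex_apply (hCc : Convex ℝ C) (hCT : C ⊆ (extChartAt I p).target) (hc : c ∈ C)
    {σ : SingularSimplex M n} (hσ : σ.range ⊆ chartSet I p C)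
    (θ : Fin (k + 1) → Fin (n + 1) × Fin 2) {x : Fin (k + 1) → ℝ} (hx : x ∈ stdSimplex ℝ (Fin (k + 1))) :
    (prismSimplex hCc hCT hc σ hσ θ).bext x = prismChartFun I p c σ θ x := by
  rw [SingularSimplex.bext_apply_of_mem _ hx, toContinuousMap_prismSimplex_apply, prismFun, chartCone,
    prismChartFun, ← prismHeightLin_eq, ← SingularSimplex.bext_coe, ← prismBaseLin_eq_coe]
  rfl

/-- **Prism simplices of a smooth simplex are smooth.** For `σ` smooth with image in the
chart-convex set, every prism simplex `σ_θ` of the chart contraction is smooth: within `Δᵏ` it is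
`e⁻¹ ∘ (affine combination of e ∘ σ~ ∘ linear and a constant)`, a composite of maps `C^∞` within
the relevant sets (Bredon (1993), proof of Thm. V.9.5: the prism operator of a smooth homotopy
preserves smooth chains; Lee (2013), proof of Thm. 18.7). [cite: Bredon1993, Thm. V.9.5] -/
theorem isSmooth_prismSimplex (hCc : Convex ℝ C) (hCT : C ⊆ (extChartAt I p).target) (hc : c ∈ C)
    {σ : SingularSimplex M n} (hs : σ.IsSmooth I) (hσ : σ.range ⊆ chartSet I p C)
    (θ : Fin (k + 1) → Fin (n + 1) × Fin 2) : (prismSimplex hCc hCT hc σ hσ θ).IsSmooth I := by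
  -- the chart expression is `C^∞` within `Δᵏ`
  have hmem : ∀ x ∈ stdSimplex ℝ (Fin (k + 1)), σ.bext (prismBaseLin θ x) ∈ chartSet I p C :=
    fun x hx ↦ σ.mapsTo_bext_range (prismBaseLin_mem θ hx) |> hσ
  have h1 : ContMDiffOn 𝓘(ℝ, Fin (k + 1) → ℝ) I ∞ (fun x ↦ σ.bext (prismBaseLin θ x)) (stdSimplex ℝ (Fin (k + 1))) :=
    hs.comp (contDiff_prismBaseLin θ).contMDiff.contMDiffOn fun x hx ↦ prismBaseLin_mem θ hx
  have h2 : ContMDiffOn 𝓘(ℝ, Fin (k + 1) → ℝ) 𝓘(ℝ, E) ∞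
      (fun x ↦ extChartAt I p (σ.bext (prismBaseLin θ x))) (stdSimplex ℝ (Fin (k + 1))) :=
    (contMDiffOn_extChartAt (n := ∞) (x := p)).comp h1 fun x hx ↦ by
      rw [mem_preimage, ← extChartAt_source I]; exact (hmem x hx).1
  have hh : ContMDiff 𝓘(ℝ, Fin (k + 1) → ℝ) 𝓘(ℝ, ℝ) ∞ (prismHeightLin θ) :=
    (contDiff_prismHeightLin θ).contMDiff
  have h3 : ContMDiffOn 𝓘(ℝ, Fin (k + 1) → ℝ) 𝓘(ℝ, E) ∞
      (fun x ↦ (1 - prismHeightLin θ x) • extChartAt I p (σ.bext (prismBaseLin θ x)) +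
        prismHeightLin θ x • c) (stdSimplex ℝ (Fin (k + 1))) :=
    ((contMDiff_const.sub hh).contMDiffOn.smul h2).add (hh.contMDiffOn.smul contMDiffOn_const)
  have hrange : ∀ x ∈ stdSimplex ℝ (Fin (k + 1)),
      (1 - prismHeightLin θ x) • extChartAt I p (σ.bext (prismBaseLin θ x)) + prismHeightLin θ x • c ∈
        (extChartAt I p).target := fun x hx ↦ by
    refine hCT (chartCone_arg_mem p hCc hc (hmem x hx) ?_)
    rw [show x = ((⟨x, hx⟩ : StdSimplex k) : Fin (k + 1) → ℝ) from rfl, prismHeightLin_eq]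
    exact prismHeight_mem_Icc θ _
  have h4 : ContMDiffOn 𝓘(ℝ, Fin (k + 1) → ℝ) I ∞ (prismChartFun I p c σ θ) (stdSimplex ℝ (Fin (k + 1))) :=
    (contMDiffOn_extChartAt_symm (n := ∞) p).comp h3 hrange
  exact h4.congr fun x hx ↦ bext_prismSimplex_apply hCc hCT hc hσ θ hx

/-- **The prism operator preserves the smooth chains in the chart-convex set.** [cite: Bredon1993, Thm. V.9.5] -/
theorem prismOp_mem_smoothChainsInSub (hCc : Convex ℝ C) (hCT : C ⊆ (extChartAt I p).target) (hc : c ∈ C)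
    (R : Type v) [CommRing R] (A : Type v) [AddCommGroup A] [Module R A]
    {x : CChain A M n} (hx : x ∈ smoothChainsInSub I R A M (chartSet I p C) n) :
    prismOp hCc hCT hc R A n x ∈ smoothChainsInSub I R A M (chartSet I p C) (n + 1) := by
  refine ⟨?_, prismOp_mem_chainsIn hCc hCT hc hx.2⟩
  rw [← Finsupp.sum_single x, Finsupp.sum, map_sum]
  refine Submodule.sum_mem _ fun σ hσ ↦ ?_
  have hs : σ.IsSmooth I := (mem_smoothChains_iff x).1 hx.1 σ hσ
  have hU : σ.range ⊆ chartSet I p C := (mem_chainsIn_iff R A x).1 hx.2 σ hσ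
  rw [prismOp_single hCc hCT hc hU]
  exact Submodule.sum_mem _ fun i _ ↦ Submodule.smul_mem _ _
    (single_mem_smoothChains (isSmooth_prismSimplex hCc hCT hc hs hU _) _)

omit [IsManifold I ∞ M] in
/-- Constant simplices are smooth. [folklore] -/
theorem isSmooth_constAt (q : M) (n : ℕ) : (SingularSimplex.constAt q n).IsSmooth I :=
  SingularSimplex.isSmooth_of_forall_eq q fun t ↦ SingularSimplex.toContinuousMap_constAt_apply q n t

omit [IsManifold I ∞ M] in
/-- The constant simplices at the cone point are smooth chains in the chart-convex set. [folklore] -/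
theorem single_constAt_mem_smoothChainsInSub (hCT : C ⊆ (extChartAt I p).target) (hc : c ∈ C)
    (R : Type v) [CommRing R] (n : ℕ) :
    Finsupp.single (SingularSimplex.constAt ((extChartAt I p).symm c) n) (1 : R) ∈
      smoothChainsInSub I R R M (chartSet I p C) n :=
  single_mem_smoothChainsInSub (isSmooth_constAt _ n) (range_constAt_symm_subset hCT hc n) 1

omit [IsManifold I ∞ M] in
/-- The constant simplices at the cone point are chains in the chart-convex set. [folklore] -/
theorem single_constAt_mem_chainsInSub (hCT : C ⊆ (extChartAt I p).target) (hc : c ∈ C)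
    (R : Type v) [CommRing R] (n : ℕ) :
    Finsupp.single (SingularSimplex.constAt ((extChartAt I p).symm c) n) (1 : R) ∈
      chainsInSub R R M (chartSet I p C) n :=
  single_mem_chainsIn R R (range_constAt_symm_subset hCT hc n) 1

end Smooth

/-! ### Cohomology of smooth and of all cochains on a chart-convex set -/

section Cohomology

variable [IsManifold I ∞ M] (hCc : Convex ℝ C) (hCT : C ⊆ (extChartAt I p).target) (hc : c ∈ C)
  {R : Type v} [CommRing R] (N : ModuleCat.{max u v} R)

include hCc hCT hc in
/-- **Positive-degree cohomology of the smooth cochains of a chart-convex set vanishes**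
(Bredon (1993), Lemma V.9.2, smooth case). [cite: Bredon1993, Lemma V.9.2] -/
theorem isZero_homology_smoothSubsetCochains_chartSet (q : ℕ) :
    IsZero ((smoothSubsetCochains I R N M (chartSet I p C)).homology (q + 1)) :=
  isZero_homology_dualObj_succ hCc hCT hc N (smoothChainsInSub I R R M (chartSet I p C))
    (fun _ ↦ inf_le_right) (fun _ _ hx ↦ prismOp_mem_smoothChainsInSub hCc hCT hc R R hx)
    (fun n ↦ single_constAt_mem_smoothChainsInSub hCT hc R n) q

omit [IsManifold I ∞ M] in
include hCc hCT hc in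
/-- **Positive-degree cohomology of all cochains of a chart-convex set vanishes**
(Bredon (1993), Lemma V.9.2; equivalently the contractibility of a convex set). [cite: Bredon1993, Lemma V.9.2] -/
theorem isZero_homology_subsetCochains_chartSet (q : ℕ) :
    IsZero ((subsetCochains R N (chartSet I p C)).homology (q + 1)) :=
  isZero_homology_dualObj_succ hCc hCT hc N (chainsInSub R R M (chartSet I p C))
    (fun _ ↦ le_rfl) (fun _ _ hx ↦ prismOp_mem_chainsIn hCc hCT hc hx)
    (fun n ↦ single_constAt_mem_chainsInSub hCT hc R n) q

/-- A morphism between zero objects is an isomorphism. [folklore] -/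
theorem isIso_of_isZero {𝒞 : Type*} [Category 𝒞] [HasZeroMorphisms 𝒞] {X Y : 𝒞} (hX : IsZero X)
    (hY : IsZero Y) (f : X ⟶ Y) : IsIso f :=
  ⟨⟨0, hX.eq_of_src _ _, hY.eq_of_tgt _ _⟩⟩

/-! #### Degree `0`: every `0`-simplex is smooth -/

omit [IsManifold I ∞ M] in
/-- In degree `0` the smooth chains in `U` are all the chains in `U`. [folklore] -/
theorem smoothChainsInSub_zero (U : Set M) : smoothChainsInSub I R R M U 0 = chainsIn R R M U 0 := by
  change smoothChains I R R M 0 ⊓ chainsIn R R M U 0 = chainsIn R R M U 0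
  refine inf_eq_right.2 fun x _ ↦ ?_
  exact (mem_smoothChains_iff x).2 fun σ _ ↦ SingularSimplex.isSmooth_of_zero σ

omit [IsManifold I ∞ M] in
/-- The identification of all `0`-chains in `U` with the smooth ones, as a linear map. [folklore] -/
def zeroChainsToSmooth (U : Set M) : ↥(chainsIn R R M U 0) →ₗ[R] ↥(smoothChainsInSub I R R M U 0) :=
  (Submodule.inclusion (le_of_eq (smoothChainsInSub_zero (I := I) (R := R) U).symm))

omit [IsManifold I ∞ M] in
/-- Values of the identification. [folklore] -/
@[simp]
theorem zeroChainsToSmooth_apply_val (U : Set M) (x : ↥(chainsIn R R M U 0)) :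
    (zeroChainsToSmooth (I := I) (R := R) U x).1 = x.1 :=
  rfl

omit [IsManifold I ∞ M] in
/-- Every chain in `U` of degree `0` is the image of a smooth one under the inclusion. [folklore] -/
theorem incl_zeroChainsToSmooth (U : Set M) (x : (chainsInSub R R M U).toComplex.X 0) :
    (Subcomplex.incl (smoothChainsInSub_le_chainsInSub (I := I) (R := R) (A := R) U)).f 0
      (zeroChainsToSmooth (I := I) (R := R) U x) = x :=
  Subtype.ext rfl

omit [IsManifold I ∞ M] in
/-- Every smooth chain in `U` of degree `0`, included and identified back, is itself. [folklore] -/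
theorem zeroChainsToSmooth_incl (U : Set M) (x : (smoothChainsInSub I R R M U).toComplex.X 0) :
    zeroChainsToSmooth (I := I) (R := R) U
      ((Subcomplex.incl (smoothChainsInSub_le_chainsInSub (I := I) (R := R) (A := R) U)).f 0 x) = x :=
  Subtype.ext rfl

/-- `prev 0 = 0` for the cohomological shape (no predecessor). [folklore] -/
theorem symm_down_prev_zero : (ComplexShape.down ℕ).symm.prev 0 = 0 := by
  rw [ComplexShape.prev, dif_neg]
  rintro ⟨i, hi⟩
  change i + 1 = 0 at hi
  omega

/-- In degree `0` of a cochain complex of shape `(down ℕ).symm` every "boundary" is zero. [folklore] -/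
theorem d_prev_zero_apply {R' : Type*} [Ring R'] (K : HomologicalComplex (ModuleCat R') (ComplexShape.down ℕ).symm)
    (w : K.X 0) : K.d 0 0 w = 0 := by
  rw [K.shape 0 0 (by simp [ComplexShape.down])]
  rfl

include hCc hCT hc in
/-- A `0`-cocycle of the smooth cochains of the chart-convex set kills every boundary of a chain
in the set (it is constant on points, `cochainHom_zero_cocycle_apply_single`). [cite: Bredon1993, Lemma V.9.2] -/
theorem cochainHom_bdSub_chainsIn_eq_zero (ψ : (smoothSubsetCochains I R N M (chartSet I p C)).X 0)
    (hψ : (smoothSubsetCochains I R N M (chartSet I p C)).d 0 1 ψ = 0)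
    (x : ↥(chainsIn R R M (chartSet I p C) 1)) :
    cochainHom N (smoothChainsInSub I R R M (chartSet I p C)) ψ
      (zeroChainsToSmooth (I := I) (R := R) (chartSet I p C) (bdSub (chainsInSub R R M (chartSet I p C)) 0 x)) = 0 := by
  have hconstancy := fun (σ τ : SingularSimplex M 0)
      (hσ : Finsupp.single σ (1 : R) ∈ smoothChainsInSub I R R M (chartSet I p C) 0)
      (hτ : Finsupp.single τ (1 : R) ∈ smoothChainsInSub I R R M (chartSet I p C) 0) ↦
    cochainHom_zero_cocycle_apply_single hCc hCT hc N (smoothChainsInSub I R R M (chartSet I p C))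
      (fun _ ↦ inf_le_right) (fun _ _ hx ↦ prismOp_mem_smoothChainsInSub hCc hCT hc R R hx)
      (fun n ↦ single_constAt_mem_smoothChainsInSub hCT hc R n) ψ hψ hσ hτ
  -- the composite `x ↦ ψ(cast(∂x))` is linear; check it on elementary chains
  let Θ : ↥(chainsIn R R M (chartSet I p C) 1) →ₗ[R] N :=
    cochainHom N (smoothChainsInSub I R R M (chartSet I p C)) ψ ∘ₗ
      zeroChainsToSmooth (I := I) (R := R) (chartSet I p C) ∘ₗ bdSub (chainsInSub R R M (chartSet I p C)) 0
  change Θ x = 0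
  have hgood := (mem_chainsIn_iff R R x.1).1 x.2
  have hmemτ : ∀ τ ∈ x.1.support, Finsupp.single τ (x.1 τ) ∈ chainsIn R R M (chartSet I p C) 1 :=
    fun τ hτ ↦ single_mem_chainsIn R R (hgood τ hτ) _
  have hx : x = ∑ τ ∈ x.1.support.attach,
      (⟨Finsupp.single τ.1 (x.1 τ.1), hmemτ τ.1 τ.2⟩ : ↥(chainsIn R R M (chartSet I p C) 1)) := by
    apply Subtype.ext
    rw [Submodule.coe_sum]
    conv_lhs => rw [← Finsupp.sum_single x.1, Finsupp.sum]
    exact (Finset.sum_attach _ _).symm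
  rw [hx, map_sum]
  refine Finset.sum_eq_zero fun τ _ ↦ ?_
  -- faces of `τ` are points of `U`, and `ψ` takes the same value on them
  have hface : ∀ j : Fin 2, Finsupp.single (τ.1.face j) (1 : R) ∈ smoothChainsInSub I R R M (chartSet I p C) 0 :=
    fun j ↦ single_mem_smoothChainsInSub (SingularSimplex.isSmooth_of_zero _)
      ((SingularSimplex.range_face_subset j τ.1).trans (hgood τ.1 τ.2)) 1
  have hval : zeroChainsToSmooth (I := I) (R := R) (chartSet I p C)
        (bdSub (chainsInSub R R M (chartSet I p C)) 0 ⟨Finsupp.single τ.1 (x.1 τ.1), hmemτ τ.1 τ.2⟩) =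
      x.1 τ.1 • ((⟨_, hface 0⟩ : ↥(smoothChainsInSub I R R M (chartSet I p C) 0)) - ⟨_, hface 1⟩) := by
    apply Subtype.ext
    change csingularChainComplex.bd R 0 (Finsupp.single τ.1 (x.1 τ.1)) =
      x.1 τ.1 • ((Finsupp.single (τ.1.face 0) (1 : R) : CChain R M 0) - Finsupp.single (τ.1.face 1) 1)
    rw [csingularChainComplex.bd_single, Fin.sum_univ_two, smul_sub, Finsupp.smul_single_one,
      Finsupp.smul_single_one]
    simp only [Fin.val_zero, pow_zero, one_smul, Fin.val_one, pow_one, neg_one_smul, sub_eq_add_neg]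
  change cochainHom N (smoothChainsInSub I R R M (chartSet I p C)) ψ
    (zeroChainsToSmooth (I := I) (R := R) (chartSet I p C)
      (bdSub (chainsInSub R R M (chartSet I p C)) 0 ⟨Finsupp.single τ.1 (x.1 τ.1), hmemτ τ.1 τ.2⟩)) = 0
  rw [hval, map_smul, map_sub, hconstancy _ _ (hface 0) (hface 1), sub_self, smul_zero]

include hCc hCT hc in
/-- **`toSmooth` is an isomorphism on `H⁰` of a chart-convex set**: `0`-cochains on all and on
smooth `0`-chains are the same thing, and a smooth `0`-cocycle is a cocycle for all chains
because it is constant on points. [cite: Bredon1993, Thm. V.9.5] -/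
theorem bijective_homologyMap_toSmooth_chartSet_zero :
    Function.Bijective (HomologicalComplex.homologyMap
      (smoothSubsetCochains.toSmooth I R N (chartSet I p C)) 0) := by
  constructor
  · -- injective: a cocycle vanishing on smooth `0`-chains vanishes
    refine (homologyMap_injective_iff _).2 fun z _ hz ↦ ?_
    rw [exists_d_prev_eq_iff symm_down_prev_zero] at hz ⊢
    obtain ⟨w, hw⟩ := hz
    rw [d_prev_zero_apply] at hw
    refine ⟨0, ?_⟩
    rw [d_prev_zero_apply]
    -- `toSmooth z = 0` forces `z = 0`
    rw [dualMap_f_apply] at hw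
    refine (ModuleCat.hom_ext (LinearMap.ext fun y ↦ ?_)).symm
    have h := congrArg (fun χ : (smoothChainsInSub I R R M (chartSet I p C)).toComplex.X 0 ⟶ N ↦
      ModuleCat.Hom.hom χ (zeroChainsToSmooth (I := I) (R := R) (chartSet I p C) y)) hw
    simp only [ModuleCat.hom_comp, LinearMap.comp_apply, ModuleCat.hom_zero, LinearMap.zero_apply] at h
    rw [incl_zeroChainsToSmooth] at h
    rw [ModuleCat.hom_zero, LinearMap.zero_apply]
    exact h.symm
  · -- surjective: a smooth `0`-cocycle extends (uniquely) to a cocycle on all `0`-chains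
    refine (homologyMap_surjective_iff _).2 fun ψ hψ ↦ ?_
    rw [d_next_eq_zero_iff ((ComplexShape.down ℕ).symm.next_eq' (rfl : 0 + 1 = 1))] at hψ
    let y : (subsetCochains R N (chartSet I p C)).X 0 :=
      (ModuleCat.ofHom (cochainHom N (smoothChainsInSub I R R M (chartSet I p C)) ψ ∘ₗ
          zeroChainsToSmooth (I := I) (R := R) (chartSet I p C)) :
        (chainsInSub R R M (chartSet I p C)).toComplex.X 0 ⟶ N)
    refine ⟨y, ?_, ?_⟩
    · -- `y` is a cocycle
      rw [d_next_eq_zero_iff ((ComplexShape.down ℕ).symm.next_eq' (rfl : 0 + 1 = 1)), dualObj_d_apply]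
      refine ModuleCat.hom_ext (LinearMap.ext fun x ↦ ?_)
      change cochainHom N (smoothChainsInSub I R R M (chartSet I p C)) ψ
        (zeroChainsToSmooth (I := I) (R := R) (chartSet I p C) ((chainsInSub R R M (chartSet I p C)).toComplex.d 1 0 x)) = 0
      rw [toComplex_d_eq_bdSub]
      exact cochainHom_bdSub_chainsIn_eq_zero hCc hCT hc N ψ hψ x
    · rw [exists_d_prev_eq_iff symm_down_prev_zero]
      refine ⟨0, ?_⟩
      rw [d_prev_zero_apply, eq_comm, sub_eq_zero, dualMap_f_apply]
      refine ModuleCat.hom_ext (LinearMap.ext fun x ↦ ?_)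
      change cochainHom N (smoothChainsInSub I R R M (chartSet I p C)) ψ x =
        cochainHom N (smoothChainsInSub I R R M (chartSet I p C)) ψ (zeroChainsToSmooth (I := I) (R := R) (chartSet I p C)
          ((Subcomplex.incl (smoothChainsInSub_le_chainsInSub (I := I) (R := R) (A := R) (chartSet I p C))).f 0 x))
      rw [zeroChainsToSmooth_incl]

include hCc hCT hc in
/-- **Restriction to smooth chains is an isomorphism on the cohomology of a chart-convex set**, in
every degree (Bredon (1993), Lemma V.9.2 with Thm. V.9.5, base case of the bootstrap; Lee (2013),
Thm. 18.7, Step 1). [cite: Bredon1993, Thm. V.9.5] -/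
theorem isIso_homologyMap_toSmooth_chartSet (q : ℕ) :
    IsIso (HomologicalComplex.homologyMap (smoothSubsetCochains.toSmooth I R N (chartSet I p C)) q) := by
  cases q with
  | zero =>
    exact (ConcreteCategory.isIso_iff_bijective _).2 (bijective_homologyMap_toSmooth_chartSet_zero hCc hCT hc N)
  | succ q =>
    exact isIso_of_isZero (isZero_homology_subsetCochains_chartSet hCc hCT hc N q)
      (isZero_homology_smoothSubsetCochains_chartSet hCc hCT hc N q) _

end Cohomology

end Literature.Geometry.Manifold
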